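import Mathlib
import Literature.Computability.AlgebraicComplexity.Apolarity
import Literature.Computability.AlgebraicComplexity.ApolarityAction

/-!
# Border apolarity, crux `ToricFixedPoints` — toric limits are initial spans: elementary lemmas

Route `ValiantsHypothesis/BorderApolarity`, crux item `stmt-ValiantsHypothesis-5779`, line
`bb-cell-state-polytope`, helper file 1 for stub `stub_toricLimitIsInitial`.

Elementary facts used by the proof that along a toric curve `t ↦ u·diag((t+2)^w)·f` the
degree-wise Kuratowski limit of the annihilators is the translate of the span of the lowest
`w`-weight initial forms of `Ann_k(f)`:

* `tli_coeff_linSubst_diagonal`, `tli_coeff_linSubst_torus` — a diagonal substitution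
  `diag(c)` rescales the coefficient of `x^d` by `∏ cᵢ^{dᵢ}`; for `cᵢ = b^{wᵢ}` this is `b^{⟨w,d⟩}`;
* `tli_tendsto_coeffVec_linSubst` — a linear substitution is coefficientwise continuous on
  degree-`k` forms;
* `tli_tendsto_zpow_neg` — `(ψ t + 2)^z → 0` for `z < 0` along `ψ → ∞`;
* `toricLimitIsInitial_flatness` (registered sub-goal) — **flatness of the initial degeneration**:
  for a subspace `W` of degree-`k` forms, the span of the lowest-weight initial forms of its
  elements has dimension at least `dim W` (induction on `dim W`, splitting off the bottom weight).
-/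

open MvPolynomial Filter
open scoped BigOperators Matrix Topology
open Literature.Computability.AlgebraicComplexity

namespace Summit.ValiantsHypothesis.ValiantsHypothesis.Theorems.BorderApolarityToricFixedPoints

set_option linter.dupNamespace false

/-! ## Diagonal substitutions rescale coefficients -/

section Diagonal

variable {σ : Type*} [Fintype σ] [DecidableEq σ] {K : Type*} [Field K]

/-- A diagonal substitution rescales each variable: `diag(c) · Xᵢ = cᵢ Xᵢ`. [folklore] -/
theorem tli_linSubst_diagonal_X (c : σ → K) (i : σ) :
    linSubst σ K (Matrix.diagonal c) (X i) = c i • X i := by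
  rw [linSubst_X, Finset.sum_eq_single i]
  · rw [Matrix.diagonal_apply_eq]
  · intro j _ hji
    rw [Matrix.diagonal_apply_ne _ hji, zero_smul]
  · intro h
    exact absurd (Finset.mem_univ i) h

/-- A diagonal substitution rescales monomials: `diag(c) · (a x^e) = (a ∏ᵢ cᵢ^{eᵢ}) x^e`. [folklore] -/
theorem tli_linSubst_diagonal_monomial (c : σ → K) (e : σ →₀ ℕ) (a : K) :
    linSubst σ K (Matrix.diagonal c) (monomial e a) =
      monomial e (a * ∏ i ∈ e.support, c i ^ e i) := by
  have h1 : linSubst σ K (Matrix.diagonal c) = aeval fun i => c i • X i := by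
    apply MvPolynomial.algHom_ext
    intro i
    rw [tli_linSubst_diagonal_X, aeval_X]
  rw [h1, aeval_monomial, Finsupp.prod]
  have h2 : ∀ i ∈ e.support, (c i • X i : MvPolynomial σ K) ^ e i = C (c i ^ e i) * X i ^ e i := by
    intro i _
    rw [smul_eq_C_mul, mul_pow, map_pow]
  rw [Finset.prod_congr rfl h2, Finset.prod_mul_distrib, ← map_prod, prod_X_pow_eq_monomial,
    C_mul_monomial, mul_one, algebraMap_eq, C_mul_monomial]

/-- Coefficients under a diagonal substitution: `coeff_d (diag(c) · p) = (∏ᵢ cᵢ^{dᵢ}) coeff_d p`.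
[folklore] -/
theorem tli_coeff_linSubst_diagonal (c : σ → K) (p : MvPolynomial σ K) (d : σ →₀ ℕ) :
    coeff d (linSubst σ K (Matrix.diagonal c) p) = (∏ i ∈ d.support, c i ^ d i) * coeff d p := by
  induction p using MvPolynomial.induction_on' with
  | monomial e a =>
    rw [tli_linSubst_diagonal_monomial, coeff_monomial, coeff_monomial]
    split_ifs with h
    · subst h
      ring
    · rw [mul_zero]
  | add p q hp hq =>
    rw [map_add, coeff_add, coeff_add, hp, hq, mul_add]

omit [Fintype σ] in
/-- The torus character on a monomial: `∏ᵢ (b^{wᵢ})^{dᵢ} = b^{⟨w,d⟩}` (`⟨w,d⟩ = Finsupp.weight w d`).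
[folklore] -/
theorem tli_prod_zpow_pow_eq (b : K) (hb : b ≠ 0) (w : σ → ℤ) (d : σ →₀ ℕ) :
    (∏ i ∈ d.support, (b ^ w i) ^ d i) = b ^ Finsupp.weight w d := by
  rw [Finsupp.weight_apply, Finsupp.sum]
  induction d.support using Finset.induction_on with
  | empty => simp
  | insert a s ha ih =>
    rw [Finset.prod_insert ha, Finset.sum_insert ha, ih, zpow_add₀ hb, ← zpow_natCast, ← zpow_mul,
      nsmul_eq_mul, mul_comm (w a)]

/-- Coefficients under the torus `diag(b^w)`: `coeff_d (diag(b^w) · p) = b^{⟨w,d⟩} coeff_d p`.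
[folklore] -/
theorem tli_coeff_linSubst_torus (b : K) (hb : b ≠ 0) (w : σ → ℤ) (p : MvPolynomial σ K)
    (d : σ →₀ ℕ) :
    coeff d (linSubst σ K (Matrix.diagonal fun i => b ^ w i) p) = b ^ Finsupp.weight w d * coeff d p := by
  rw [tli_coeff_linSubst_diagonal, tli_prod_zpow_pow_eq b hb w d]

/-- The torus matrix `diag(b^w)` is invertible for `b ≠ 0`. [folklore] -/
theorem tli_isUnit_det_diagonal_zpow (b : K) (hb : b ≠ 0) (w : σ → ℤ) :
    IsUnit (Matrix.diagonal fun i : σ => b ^ w i).det := by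
  rw [Matrix.det_diagonal, isUnit_iff_ne_zero]
  exact Finset.prod_ne_zero_iff.2 fun i _ => zpow_ne_zero _ hb

/-- Inverse torus substitution: `diag(b^w) · (diag(b^{-w}) · p) = p`. [folklore] -/
theorem tli_linSubst_torus_linSubst_torus_neg (b : K) (hb : b ≠ 0) (w : σ → ℤ) (p : MvPolynomial σ K) :
    linSubst σ K (Matrix.diagonal fun i => b ^ w i)
      (linSubst σ K (Matrix.diagonal fun i => b ^ (-w i)) p) = p := by
  rw [← AlgHom.comp_apply, ← linSubst_mul, Matrix.diagonal_mul_diagonal]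
  have : (fun i : σ => b ^ w i * b ^ (-w i)) = fun _ => 1 := by
    funext i
    rw [← zpow_add₀ hb, add_neg_cancel, zpow_zero]
  rw [this, Matrix.diagonal_one, linSubst_one, AlgHom.id_apply]

end Diagonal

/-! ## Weighted homogeneous components of forms -/

section Weighted

variable {σ : Type*} {K : Type*} [Field K]

/-- A weighted homogeneous component of a degree-`k` form is a degree-`k` form. [folklore] -/
theorem tli_isHomogeneous_weightedHomogeneousComponent (w : σ → ℤ) (ν : ℤ) {p : MvPolynomial σ K}
    {k : ℕ} (hp : p.IsHomogeneous k) : (weightedHomogeneousComponent w ν p).IsHomogeneous k := by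
  classical
  intro d hd
  rw [coeff_weightedHomogeneousComponent] at hd
  split_ifs at hd with h
  · exact hp hd
  · exact absurd rfl hd

/-- Components of components: `π_ν (π_ν' p) = δ_{ν ν'} π_ν' p`. [folklore] -/
theorem tli_weightedHomogeneousComponent_weightedHomogeneousComponent (w : σ → ℤ) (ν ν' : ℤ)
    (p : MvPolynomial σ K) :
    weightedHomogeneousComponent w ν (weightedHomogeneousComponent w ν' p) =
      if ν = ν' then weightedHomogeneousComponent w ν' p else 0 :=
  weightedHomogeneousComponent_of_mem (weightedHomogeneousComponent_mem w p ν')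

/-- If the weight-`ν` component of `p` vanishes, so do all coefficients of weight `ν`. [folklore] -/
theorem tli_coeff_eq_zero_of_weightedHomogeneousComponent_eq_zero (w : σ → ℤ) {ν : ℤ}
    {p : MvPolynomial σ K} (h : weightedHomogeneousComponent w ν p = 0) {d : σ →₀ ℕ}
    (hd : Finsupp.weight w d = ν) : coeff d p = 0 := by
  classical
  have := congrArg (coeff d) h
  rwa [coeff_weightedHomogeneousComponent, if_pos hd, coeff_zero] at this

end Weighted


/-! ## Coefficientwise continuity of linear substitutions on forms -/

section Continuity

variable {σ : Type*} [Fintype σ] [DecidableEq σ]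

/-- A degree-`k` form is the fixed finite sum `Σ_{|e| = k} coeff_e p • x^e` over ALL degree-`k`
exponents. [folklore] -/
theorem tli_eq_sum_smul_monomial {K : Type*} [Field K] {p : MvPolynomial σ K} {k : ℕ}
    (hp : p.IsHomogeneous k) :
    p = ∑ e ∈ (Finset.univ : Finset σ).finsuppAntidiag k, coeff e p • monomial e (1 : K) := by
  have hmem : ∀ e : σ →₀ ℕ, e ∈ (Finset.univ : Finset σ).finsuppAntidiag k ↔ e.degree = k := by
    intro e
    simp [Finset.mem_finsuppAntidiag, Finsupp.degree_eq_sum]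
  conv_lhs => rw [p.as_sum]
  rw [Finset.sum_subset (s₁ := p.support)]
  · refine Finset.sum_congr rfl fun e _ => ?_
    rw [smul_monomial, smul_eq_mul, mul_one]
  · intro e he
    rw [hmem, Finsupp.degree_eq_weight_one]
    exact hp (mem_support_iff.1 he)
  · intro e _ he
    rw [notMem_support_iff.1 he, map_zero]

/-- On degree-`k` forms, `coeffVec (B · p)` is a fixed finite linear combination of the
coefficients of `p`. [folklore] -/
theorem tli_coeffVec_linSubst_eq_sum (B : Matrix σ σ ℂ) {p : MvPolynomial σ ℂ} {k : ℕ}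
    (hp : p.IsHomogeneous k) :
    coeffVec (linSubst σ ℂ B p) = ∑ e ∈ (Finset.univ : Finset σ).finsuppAntidiag k,
      coeff e p • coeffVec (linSubst σ ℂ B (monomial e (1 : ℂ))) := by
  conv_lhs => rw [tli_eq_sum_smul_monomial hp, map_sum]
  funext d
  simp only [coeffVec_apply, coeff_sum, Finset.sum_apply, Pi.smul_apply, map_smul, coeff_smul]

/-- **Linear substitutions are coefficientwise continuous on degree-`k` forms**: if the degree-`k`
forms `Ds t` converge coefficientwise to the degree-`k` form `D`, then `B · Ds t → B · D`
coefficientwise. [folklore] -/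
theorem tli_tendsto_coeffVec_linSubst (B : Matrix σ σ ℂ) {k : ℕ} {Ds : ℕ → MvPolynomial σ ℂ}
    {D : MvPolynomial σ ℂ} (hDs : ∀ t, (Ds t).IsHomogeneous k) (hD : D.IsHomogeneous k)
    (h : Tendsto (fun t => coeffVec (Ds t)) atTop (𝓝 (coeffVec D))) :
    Tendsto (fun t => coeffVec (linSubst σ ℂ B (Ds t))) atTop (𝓝 (coeffVec (linSubst σ ℂ B D))) := by
  have h1 : (fun t => coeffVec (linSubst σ ℂ B (Ds t))) = fun t =>
      ∑ e ∈ (Finset.univ : Finset σ).finsuppAntidiag k,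
        coeff e (Ds t) • coeffVec (linSubst σ ℂ B (monomial e (1 : ℂ))) := by
    funext t
    exact tli_coeffVec_linSubst_eq_sum B (hDs t)
  rw [h1, tli_coeffVec_linSubst_eq_sum B hD]
  refine tendsto_finsetSum _ fun e _ => ?_
  have h2 : Tendsto (fun t => coeffVec (Ds t) e) atTop (𝓝 (coeffVec D e)) :=
    (continuous_apply e).continuousAt.tendsto.comp h
  simp only [coeffVec_apply] at h2
  exact h2.smul_const _

end Continuity

/-! ## The scalar sequence `(ψ t + 2)^z` -/

section Scalar

/-- `(s : ℂ) + 2 ≠ 0` for a natural number `s`. [folklore] -/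
theorem tli_natCast_add_two_ne_zero (s : ℕ) : ((s : ℂ) + 2) ≠ 0 := by
  have : (0 : ℝ) < (s : ℝ) + 2 := by positivity
  exact_mod_cast this.ne'

/-- Negative powers of `ψ t + 2` tend to `0` along `ψ → ∞`. [folklore] -/
theorem tli_tendsto_zpow_neg {ψ : ℕ → ℕ} (hψ : Tendsto ψ atTop atTop) {z : ℤ} (hz : z < 0) :
    Tendsto (fun t => ((ψ t : ℂ) + 2) ^ z) atTop (𝓝 0) := by
  have h1 : Tendsto (fun t => ((ψ t : ℝ) + 2)) atTop atTop :=
    tendsto_atTop_add_const_right _ _ (tendsto_natCast_atTop_atTop.comp hψ)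
  have h2 : Tendsto (fun t => ((ψ t : ℝ) + 2) ^ z) atTop (𝓝 0) := (tendsto_zpow_atTop_zero hz).comp h1
  have h3 := (Complex.continuous_ofReal.tendsto 0).comp h2
  have h4 : (fun t => (((((ψ t : ℝ) + 2) ^ z : ℝ) : ℂ))) = fun t => ((ψ t : ℂ) + 2) ^ z := by
    funext t
    push_cast
    ring
  rw [Complex.ofReal_zero] at h3
  rwa [show (Complex.ofReal ∘ fun t => ((ψ t : ℝ) + 2) ^ z) =
    fun t => (((((ψ t : ℝ) + 2) ^ z : ℝ) : ℂ)) from rfl, h4] at h3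

end Scalar

/-! ## Flatness of the initial degeneration -/

/-- **Flatness** (registered sub-goal `toricLimitIsInitial_flatness` of stub `stub_toricLimitIsInitial`):
for a subspace `W` of degree-`k` forms and an integer weight `w`, the span of the lowest-`w`-weight
initial forms of the elements of `W` has dimension at least `dim W` (induction on `dim W`: split `W`
by the bottom weight `n₀` occurring in `W` into `G = W ∩ ker π_{n₀}` and `π_{n₀}(W)`; the initial
span of `W` contains the direct sum of the initial span of `G` and `π_{n₀}(W)`).  Model:
`GradedLimit.finrank_grSub`. [folklore] -/
theorem toricLimitIsInitial_flatness :
    ∀ {σ : Type} [Fintype σ] (w : σ → ℤ) (k : ℕ) (W : Submodule ℂ (MvPolynomial σ ℂ)),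
      W ≤ MvPolynomial.homogeneousSubmodule σ ℂ k →
      Module.finrank ℂ W ≤ Module.finrank ℂ ↥(Submodule.span ℂ {D : MvPolynomial σ ℂ | ∃ E ∈ W,
        ∃ ν : ℤ, D = weightedHomogeneousComponent w ν E ∧
          ∀ ν' : ℤ, ν' < ν → weightedHomogeneousComponent w ν' E = 0}) := by
  intro σ _ w k W hW
  classical
  haveI hfin : Module.Finite ℂ (homogeneousSubmodule σ ℂ k) :=
    Module.Finite.iff_fg.2 (homogeneousSubmodule_fg σ ℂ k)
  -- the finitely many weights of the degree-`k` monomials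
  set Wts : Finset ℤ := ((Finset.univ : Finset σ).finsuppAntidiag k).image (Finsupp.weight w)
    with hWts
  have hmemWts : ∀ {p : MvPolynomial σ ℂ}, p ∈ homogeneousSubmodule σ ℂ k → ∀ d ∈ p.support,
      Finsupp.weight w d ∈ Wts := by
    intro p hp d hd
    refine Finset.mem_image_of_mem _ ?_
    have hdeg : d.degree = k := by
      rw [Finsupp.degree_eq_weight_one]
      exact (mem_homogeneousSubmodule k p).1 hp (mem_support_iff.1 hd)
    simpa [Finset.mem_finsuppAntidiag, Finsupp.degree_eq_sum] using hdeg
  -- strong induction on `dim W`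
  suffices H : ∀ d : ℕ, ∀ W : Submodule ℂ (MvPolynomial σ ℂ), W ≤ homogeneousSubmodule σ ℂ k →
      Module.finrank ℂ W = d → d ≤ Module.finrank ℂ (Submodule.span ℂ {D : MvPolynomial σ ℂ |
        ∃ E ∈ W, ∃ ν : ℤ, D = weightedHomogeneousComponent w ν E ∧
          ∀ ν' : ℤ, ν' < ν → weightedHomogeneousComponent w ν' E = 0}) from
    (H _ W hW rfl)
  intro d
  induction d using Nat.strong_induction_on with
  | _ d ih =>
  intro W hW hWd
  haveI : FiniteDimensional ℂ W := Submodule.finiteDimensional_of_le hW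
  by_cases hbot : W = ⊥
  · subst hbot
    rw [finrank_bot] at hWd
    omega
  -- the bottom weight `n₀` occurring in `W`
  obtain ⟨E₀, hE₀W, hE₀⟩ := (Submodule.ne_bot_iff W).1 hbot
  obtain ⟨d₀, hd₀⟩ := ne_zero_iff.1 hE₀
  set T : Finset ℤ := Wts.filter fun ν => ∃ E ∈ W, weightedHomogeneousComponent w ν E ≠ 0 with hT
  have hTne : T.Nonempty := by
    refine ⟨Finsupp.weight w d₀, Finset.mem_filter.2 ⟨hmemWts (hW hE₀W) d₀ (mem_support_iff.2 hd₀),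
      E₀, hE₀W, fun h => hd₀ ?_⟩⟩
    exact tli_coeff_eq_zero_of_weightedHomogeneousComponent_eq_zero w h rfl
  obtain ⟨n₀, hn₀T, hmin⟩ := Finset.exists_min_image T id hTne
  obtain ⟨-, E₁, hE₁W, hE₁⟩ := Finset.mem_filter.1 hn₀T
  -- below `n₀` all components vanish on `W`
  have hlow : ∀ E ∈ W, ∀ ν' : ℤ, ν' < n₀ → weightedHomogeneousComponent w ν' E = 0 := by
    intro E hE ν' hν'
    by_contra hne
    obtain ⟨e, he⟩ := ne_zero_iff.1 hne
    rw [coeff_weightedHomogeneousComponent] at he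
    split_ifs at he with hwe
    · have hν'T : ν' ∈ T :=
        Finset.mem_filter.2 ⟨hwe ▸ hmemWts (hW hE) e (mem_support_iff.2 he), E, hE, hne⟩
      exact absurd (hmin ν' hν'T) (not_le.2 hν')
    · exact he rfl
  -- split off the weight-`n₀` part: `G = W ∩ ker π_{n₀}`, `Wn = π_{n₀}(W)`
  set πn : MvPolynomial σ ℂ →ₗ[ℂ] MvPolynomial σ ℂ := weightedHomogeneousComponent w n₀ with hπn
  set φ : W →ₗ[ℂ] MvPolynomial σ ℂ := πn.domRestrict W with hφ
  set Wn : Submodule ℂ (MvPolynomial σ ℂ) := LinearMap.range φ with hWn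
  set G : Submodule ℂ (MvPolynomial σ ℂ) := (LinearMap.ker φ).map W.subtype with hG
  have hGW : G ≤ W := by
    rintro _ ⟨x, -, rfl⟩
    exact x.2
  have hGker : ∀ v ∈ G, πn v = 0 := by
    rintro _ ⟨x, hx, rfl⟩
    simpa [hφ] using hx
  have hdim : Module.finrank ℂ G + Module.finrank ℂ Wn = d := by
    have h1 := LinearMap.finrank_range_add_finrank_ker φ
    rw [← hWn, hWd] at h1
    have h2 : Module.finrank ℂ G = Module.finrank ℂ (LinearMap.ker φ) :=
      Submodule.finrank_map_subtype_eq W (LinearMap.ker φ)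
    omega
  have hWn_pos : 0 < Module.finrank ℂ Wn := by
    rw [Module.finrank_pos_iff_exists_ne_zero]
    exact ⟨⟨πn E₁, ⟨⟨E₁, hE₁W⟩, rfl⟩⟩, fun h => hE₁ (congrArg Subtype.val h)⟩
  have hGlt : Module.finrank ℂ G < d := by omega
  have ihG := ih _ hGlt G (hGW.trans hW) rfl
  -- the two initial spans
  set InW := Submodule.span ℂ {D : MvPolynomial σ ℂ | ∃ E ∈ W, ∃ ν : ℤ,
    D = weightedHomogeneousComponent w ν E ∧
      ∀ ν' : ℤ, ν' < ν → weightedHomogeneousComponent w ν' E = 0} with hInW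
  set InG := Submodule.span ℂ {D : MvPolynomial σ ℂ | ∃ E ∈ G, ∃ ν : ℤ,
    D = weightedHomogeneousComponent w ν E ∧
      ∀ ν' : ℤ, ν' < ν → weightedHomogeneousComponent w ν' E = 0} with hInG
  have hInW_le : InW ≤ homogeneousSubmodule σ ℂ k := by
    refine Submodule.span_le.2 ?_
    rintro _ ⟨E, hE, ν, rfl, -⟩
    exact (mem_homogeneousSubmodule k _).2 (tli_isHomogeneous_weightedHomogeneousComponent w ν
      ((mem_homogeneousSubmodule k E).1 (hW hE)))
  haveI : FiniteDimensional ℂ InW := Submodule.finiteDimensional_of_le hInW_le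
  have hInG_le : InG ≤ InW := by
    refine Submodule.span_mono ?_
    rintro _ ⟨E, hE, ν, rfl, h⟩
    exact ⟨E, hGW hE, ν, rfl, h⟩
  haveI : FiniteDimensional ℂ InG := Submodule.finiteDimensional_of_le hInG_le
  have hWn_le : Wn ≤ InW := by
    rintro _ ⟨⟨E, hE⟩, rfl⟩
    exact Submodule.subset_span ⟨E, hE, n₀, rfl, hlow E hE⟩
  -- `InG ⊓ Wn = ⊥`: `InG ≤ ker π_{n₀}` while `π_{n₀}` fixes `Wn`
  have hinf : InG ⊓ Wn = ⊥ := by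
    rw [eq_bot_iff]
    rintro x ⟨hxG, hxW⟩
    have hx1 : πn x = 0 := by
      have hle : InG ≤ LinearMap.ker πn := by
        refine Submodule.span_le.2 ?_
        rintro _ ⟨E, hE, ν, rfl, -⟩
        rw [SetLike.mem_coe, LinearMap.mem_ker, hπn,
          tli_weightedHomogeneousComponent_weightedHomogeneousComponent]
        split_ifs with h
        · subst h
          exact hGker E hE
        · rfl
      exact hle hxG
    have hx2 : πn x = x := by
      obtain ⟨⟨E, hE⟩, rfl⟩ := hxW
      simp [hφ, hπn, tli_weightedHomogeneousComponent_weightedHomogeneousComponent]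
    rw [Submodule.mem_bot, ← hx2, hx1]
  have h1 := Submodule.finrank_sup_add_finrank_inf_eq InG Wn
  rw [hinf, finrank_bot, add_zero] at h1
  have h2 := Submodule.finrank_mono (sup_le hInG_le hWn_le)
  omega


end Summit.ValiantsHypothesis.ValiantsHypothesis.Theorems.BorderApolarityToricFixedPoints
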